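import Literature.Analysis.OperatorTheory.PositiveKernelTransferOperator
import HarnessLib

/-!
# Venture YMGap, track Y3 FLOW-DATA — Schur's test for a bounded non-negative kernel on a probability space
# (theorems only; generic tool for `FlowData/TubeTorelonEnvelope.lean`)

HONEST FRAMING: venture file of the cell `pub-ymgap` (QuantumFields programme), track Y3; pure operator theory, no
physics content.  Companion of `Literature/Analysis/OperatorTheory/PositiveKernelTransferOperator.lean` (the `L²` operator
`A` of a bounded strongly measurable kernel `K`, `(A φ)(x) = ∫ K(x,y) φ(y) dμ(y)` a.e., `inner_kernelOp_eq_integral`,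
`integrable_mul_kernel_mul`).  **Schur's test** (I. Schur 1911; Halmos–Sunder, *Bounded integral operators on L²
spaces* (1978), Thm. 5.2, with the constant test function): if `K ≥ 0` has row integrals `∫ K(x,y) dμ(y) ≤ R` and
column integrals `∫ K(x,y) dμ(x) ≤ R`, then `|⟪ψ, Aφ⟫| ≤ (R/2)(‖ψ‖² + ‖φ‖²)` (`abs_inner_kernelOp_le`, AM–GM under the
double integral and Fubini) and hence **`‖A‖ ≤ R`** (`norm_kernelOp_le_of_integral_le`).  Also the bookkeeping
identity `‖ψ‖² = ∫ ψ²` for real `L²` (`norm_sq_eq_integral_sq`).  All statements are standard measure theory and are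
tagged folklore.

References: P. R. Halmos, V. S. Sunder, *Bounded Integral Operators on L² Spaces*, Springer (1978), Thm. 5.2
[folklore]; M. Reed, B. Simon, *Methods of Modern Mathematical Physics I* (1980), Thm. VI.23 context [folklore].
-/

noncomputable section

open MeasureTheory Filter Function
open Literature.Analysis.OperatorTheory

namespace Summit.Ventures.YMGap.FlowData

section SchurTest

variable {X : Type*} [MeasurableSpace X] {μ : Measure X} [IsProbabilityMeasure μ] {K : X → X → ℝ} {C : ℝ}
  {A : Lp ℝ 2 μ →L[ℝ] Lp ℝ 2 μ}

omit [IsProbabilityMeasure μ] in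
/-- `‖ψ‖² = ∫ ψ²` for `ψ ∈ L²(μ)` (real scalars). [folklore] -/
theorem norm_sq_eq_integral_sq (ψ : Lp ℝ 2 μ) : ‖ψ‖ ^ 2 = ∫ x, (ψ x) ^ 2 ∂μ := by
  rw [← real_inner_self_eq_norm_sq, MeasureTheory.L2.inner_def]
  refine integral_congr_ae (Eventually.of_forall fun x => ?_)
  simp [sq]

/-- **Schur's test (bilinear form)**: for a non-negative bounded kernel with row and column integrals `≤ R`,
`|⟪ψ, A φ⟫| ≤ (R/2)(‖ψ‖² + ‖φ‖²)`. [folklore] -/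
theorem abs_inner_kernelOp_le (hK : StronglyMeasurable (uncurry K)) (hC : ∀ x y, ‖K x y‖ ≤ C)
    (hK0 : ∀ x y, 0 ≤ K x y) {R : ℝ} (hrow : ∀ x, ∫ y, K x y ∂μ ≤ R) (hcol : ∀ y, ∫ x, K x y ∂μ ≤ R)
    (hA : ∀ φ : Lp ℝ 2 μ, (A φ : X → ℝ) =ᵐ[μ] fun x => ∫ y, K x y * φ y ∂μ) (ψ φ : Lp ℝ 2 μ) :
    |@inner ℝ _ _ ψ (A φ)| ≤ R / 2 * (‖ψ‖ ^ 2 + ‖φ‖ ^ 2) := by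
  have hint := integrable_mul_kernel_mul (μ := μ) hK hC ψ φ
  rw [inner_kernelOp_eq_integral hA ψ φ]
  have h1 : ∫ x, ψ x * ∫ y, K x y * φ y ∂μ ∂μ = ∫ z, ψ z.1 * (K z.1 z.2 * φ z.2) ∂(μ.prod μ) := by
    rw [integral_prod _ hint]
    refine integral_congr_ae (Eventually.of_forall fun x => ?_)
    exact (integral_const_mul _ _).symm
  rw [h1]
  -- the two quadratic integrals
  have hψ2 : Integrable (fun x => (ψ x) ^ 2) μ := by
    have := (Lp.memLp ψ).integrable_sq
    exact this
  have hφ2 : Integrable (fun x => (φ x) ^ 2) μ := (Lp.memLp φ).integrable_sq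
  have hIψ : Integrable (fun z : X × X => K z.1 z.2 * (ψ z.1) ^ 2) (μ.prod μ) := by
    have h := (hψ2.mul_prod (integrable_const (1 : ℝ) (μ := μ)))
    refine (h.bdd_mul hK.aestronglyMeasurable (Eventually.of_forall fun z => hC z.1 z.2)).congr
      (Eventually.of_forall fun z => ?_)
    simp [uncurry]
  have hIφ : Integrable (fun z : X × X => K z.1 z.2 * (φ z.2) ^ 2) (μ.prod μ) := by
    have h := ((integrable_const (1 : ℝ) (μ := μ)).mul_prod hφ2)
    refine (h.bdd_mul hK.aestronglyMeasurable (Eventually.of_forall fun z => hC z.1 z.2)).congr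
      (Eventually.of_forall fun z => ?_)
    simp [uncurry]
  -- pointwise AM–GM
  have hpt : ∀ z : X × X, |ψ z.1 * (K z.1 z.2 * φ z.2)| ≤ (K z.1 z.2 * (ψ z.1) ^ 2 + K z.1 z.2 * (φ z.2) ^ 2) / 2 := by
    intro z
    rw [abs_mul, abs_mul, abs_of_nonneg (hK0 _ _)]
    nlinarith [sq_nonneg (|ψ z.1| - |φ z.2|), hK0 z.1 z.2, sq_abs (ψ z.1), sq_abs (φ z.2),
      mul_nonneg (hK0 z.1 z.2) (sq_nonneg (|ψ z.1| - |φ z.2|))]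
  have h2 : |∫ z, ψ z.1 * (K z.1 z.2 * φ z.2) ∂(μ.prod μ)| ≤
      ∫ z, (K z.1 z.2 * (ψ z.1) ^ 2 + K z.1 z.2 * (φ z.2) ^ 2) / 2 ∂(μ.prod μ) :=
    (abs_integral_le_integral_abs).trans (integral_mono hint.abs ((hIψ.add hIφ).div_const 2) hpt)
  refine h2.trans ?_
  rw [integral_div, integral_add hIψ hIφ]
  -- `∫∫ K ψ(x)² = ∫ ψ² (∫ K) ≤ R ‖ψ‖²`, and the same for `φ` with the columns
  have h3 : ∫ z, K z.1 z.2 * (ψ z.1) ^ 2 ∂(μ.prod μ) ≤ R * ‖ψ‖ ^ 2 := by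
    rw [integral_prod _ hIψ, norm_sq_eq_integral_sq, ← integral_const_mul]
    refine integral_mono_of_nonneg (Eventually.of_forall fun x => ?_) (hψ2.const_mul R)
      (Eventually.of_forall fun x => ?_)
    · exact integral_nonneg fun y => mul_nonneg (hK0 _ _) (sq_nonneg _)
    · dsimp only
      rw [integral_mul_const]
      exact mul_le_mul_of_nonneg_right (hrow x) (sq_nonneg _)
  have h4 : ∫ z, K z.1 z.2 * (φ z.2) ^ 2 ∂(μ.prod μ) ≤ R * ‖φ‖ ^ 2 := by
    rw [integral_prod_symm _ hIφ, norm_sq_eq_integral_sq, ← integral_const_mul]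
    refine integral_mono_of_nonneg (Eventually.of_forall fun y => ?_) (hφ2.const_mul R)
      (Eventually.of_forall fun y => ?_)
    · exact integral_nonneg fun x => mul_nonneg (hK0 _ _) (sq_nonneg _)
    · dsimp only
      rw [integral_mul_const]
      exact mul_le_mul_of_nonneg_right (hcol y) (sq_nonneg _)
  linarith

/-- **Schur's test**: a non-negative bounded kernel on a probability space with row and column integrals `≤ R`
defines an `L²` operator of norm `≤ R`. [folklore] -/
theorem norm_kernelOp_le_of_integral_le (hK : StronglyMeasurable (uncurry K)) (hC : ∀ x y, ‖K x y‖ ≤ C)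
    (hK0 : ∀ x y, 0 ≤ K x y) {R : ℝ} (hR : 0 ≤ R) (hrow : ∀ x, ∫ y, K x y ∂μ ≤ R) (hcol : ∀ y, ∫ x, K x y ∂μ ≤ R)
    (hA : ∀ φ : Lp ℝ 2 μ, (A φ : X → ℝ) =ᵐ[μ] fun x => ∫ y, K x y * φ y ∂μ) : ‖A‖ ≤ R := by
  refine ContinuousLinearMap.opNorm_le_bound A hR fun φ => ?_
  by_cases hφ : φ = 0
  · simp [hφ]
  by_cases hAφ : A φ = 0
  · rw [hAφ, norm_zero]; exact mul_nonneg hR (norm_nonneg _)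
  have hφn : 0 < ‖φ‖ := norm_pos_iff.2 hφ
  have hAn : 0 < ‖A φ‖ := norm_pos_iff.2 hAφ
  -- test against `ψ = (‖φ‖/‖Aφ‖) • Aφ`, a vector of norm `‖φ‖`
  set t : ℝ := ‖φ‖ / ‖A φ‖ with ht
  have htpos : 0 < t := div_pos hφn hAn
  have hkey := abs_inner_kernelOp_le hK hC hK0 hrow hcol hA (t • A φ) φ
  rw [real_inner_smul_left, real_inner_self_eq_norm_sq, norm_smul, Real.norm_of_nonneg htpos.le,
    abs_of_nonneg (mul_nonneg htpos.le (sq_nonneg _))] at hkey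
  have htn : t * ‖A φ‖ = ‖φ‖ := by rw [ht, div_mul_cancel₀ _ hAn.ne']
  rw [mul_pow] at hkey
  -- `t ‖Aφ‖² = ‖φ‖ ‖Aφ‖` and `(t‖Aφ‖)² = ‖φ‖²`
  have hl : t * ‖A φ‖ ^ 2 = ‖φ‖ * ‖A φ‖ := by rw [sq, ← mul_assoc, htn]
  rw [hl, show t ^ 2 * ‖A φ‖ ^ 2 = ‖φ‖ ^ 2 by rw [← mul_pow, htn]] at hkey
  nlinarith

end SchurTest

end Summit.Ventures.YMGap.FlowData
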